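import Mathlib
import Summits.Ventures.PercRepro2.SeriesBundlesDefs

/-! # (UH*) on every series of bundles `B_{m 0} ∧ … ∧ B_{m n}` with all `m t ≥ 3`
(seat mine-b, cell pub-perc-repro2; MINE-B.md §24)

On the cube and with the three rules of SeriesBundlesDefs.lean: the assignment `sbAssign` is valid
(`sbAssign_spec`: below the source, red label `1`, blue label `≥ demand − 1`) and injective
(`sbAssign_injective`: the three images are disjoint — `ruleEmpty` has an empty bundle, the others
have none; `ruleTwo` against `ruleTheta` by the missing elements of the full bundles — and each rule
decodes its source), hence **`universal_seriesBundles`**: (UH*) holds on every series of bundles with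
all `m t ≥ 3`.  The hypothesis is harmless: a series with a bundle of `≤ 2` edges has flow `≤ 2` and is
covered by `SP.universal_of_flow_le_two` (UniversalFlow2.lean); the double bundles of
UniversalDoubleBundle.lean are the case `n = 1`. -/

namespace Summit.Ventures.PercRepro2.UHClosure

open Finset

section seriesBundles

variable {n : ℕ} {m : Fin (n + 1) → ℕ}

/-- **the assignment is valid**: below the source, red label `1`, blue label `≥ demand − 1` -/
theorem sbAssign_spec (hm : ∀ t, 3 ≤ m t) (q : SlotL (USrc (sbR m) (sbB m)) (sbB m)) :
    sbAssign q ≤ q.1.1.1 ∧ sbR m (sbAssign q) = 1 ∧ sbB m q.1.1.1 ≤ sbB m (sbAssign q) + 1 := by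
  obtain ⟨⟨f, hf⟩, h1⟩ := sb_src q.1.1.2.1
  have hi : q.1.2.val < sbB m q.1.1.1 := q.2
  have hi' : ∀ t, q.1.2.val < m t :=
    fun t => lt_of_lt_of_le hi (le_trans (sbB_le _ t) (card_le_m _ t))
  unfold sbAssign
  split_ifs with h2 hor
  · have h2' : ∀ t, 2 ≤ (q.1.1.1 t).card := fun t => le_trans h2 (sbB_le _ t)
    refine ⟨Pi.le_def.2 fun t => ?_, ?_, ?_⟩
    · by_cases h : q.1.1.1 t = univ
      · rw [ruleTheta_of_full h, h]; exact subset_univ _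
      · rw [ruleTheta_of_not_full h]; exact cascade_subset _
    · exact sbR_eq_one (ruleTheta_card_lt hi') ⟨f, (ruleTheta_oneRed_iff hi' h2' f).2 hf⟩
    · have := le_sbB (x := ruleTheta q.1.2.val q.1.1.1) (k := sbB m q.1.1.1 - 1) (fun t => by
        have := ruleTheta_card_ge (x := q.1.1.1) (i := q.1.2.val) hi' (d := sbB m q.1.1.1)
          (fun t => sbB_le _ t) t
        omega)
      omega
  · refine ⟨Pi.le_def.2 fun t => ?_, ?_, ?_⟩
    · by_cases h : q.1.1.1 t = univ
      · rw [ruleEmpty_of_full h]; exact empty_subset _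
      · rw [ruleEmpty_of_not_full h]
    · obtain ⟨t, ht⟩ := hor
      have hnf : q.1.1.1 t ≠ univ := fun e => by
        rw [(eq_univ_iff_card _ t).1 e] at ht; omega
      refine sbR_eq_one (fun t => ?_) ⟨t, by rw [ruleEmpty_of_not_full hnf]; exact ht⟩
      by_cases h : q.1.1.1 t = univ
      · rw [ruleEmpty_of_full h, card_empty]; have := hm t; omega
      · rw [ruleEmpty_of_not_full h]; exact card_lt_of_not_full h
    · omega
  · refine ⟨Pi.le_def.2 fun t => ?_, ?_, ?_⟩
    · by_cases h : q.1.1.1 t = univ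
      · rw [ruleTwo_of_full h, h]; exact subset_univ _
      · rw [ruleTwo_of_not_full h]
    · exact sbR_eq_one (ruleTwo_card_lt hm) ⟨f, (ruleTwo_oneRed_iff hm hor f).2 hf⟩
    · omega

/-- rule (θ) never meets rule (∅): the latter has an empty bundle -/
lemma ruleTheta_ne_ruleEmpty (hm : ∀ t, 3 ≤ m t) {x x' : SBConf m} {i : ℕ} (hi : ∀ t, i < m t)
    (h2 : ∀ t, 2 ≤ (x t).card) (hf' : ∃ t, x' t = univ) : ruleTheta i x ≠ ruleEmpty x' := by
  intro he
  obtain ⟨f, hf⟩ := hf'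
  have := congrFun he f
  rw [ruleEmpty_of_full hf] at this
  have hc := congrArg Finset.card this
  rw [card_empty] at hc
  by_cases h : x f = univ
  · rw [ruleTheta_of_full h] at hc; have := card_uErase (m := m) (hi f); have := hm f; omega
  · rw [ruleTheta_of_not_full h] at hc
    have := card_le_card_cascade_add_one (x f); have := h2 f; omega

/-- rule (θ) never meets rule (2) -/
lemma ruleTheta_ne_ruleTwo (hm : ∀ t, 3 ≤ m t) {x x' : SBConf m} {i : ℕ} (hi : ∀ t, i < m t)
    (hid : i < sbB m x) (h2 : ∀ t, 2 ≤ (x t).card) (hnor : ¬ HasOneRed x')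
    (hf' : ∃ t, x' t = univ) (h1' : ∀ t, 1 ≤ (x' t).card) (hd' : sbB m x' ≤ 1) :
    ruleTheta i x ≠ ruleTwo x' := by
  intro he
  have hfull : ∀ t, x t = univ ↔ x' t = univ := fun t => by
    rw [← ruleTheta_oneRed_iff hi h2 t, ← ruleTwo_oneRed_iff hm hnor t, he]
  have hne : (fullSet x').Nonempty := by
    obtain ⟨f, hf⟩ := hf'; exact ⟨f, mem_fullSet.2 hf⟩
  have hmiss : ∀ t, x' t = univ → i = twoElt x' t := fun t ht => by
    have := congrFun he t
    rw [ruleTheta_of_full ((hfull t).2 ht), ruleTwo_of_full ht] at this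
    exact uErase_inj (lt_of_lt_of_le (twoElt_lt_three x' t) (hm t)) this
  by_cases hc1 : (fullSet x').card = 1
  · obtain ⟨f, hf⟩ := hf'
    have hi2 : i = 2 := by rw [hmiss f hf]; unfold twoElt; rw [if_pos hc1]
    obtain ⟨u, hu⟩ := exists_sbB_eq x'
    have hu1 : (x' u).card = 1 := by have := h1' u; omega
    have hnf : x' u ≠ univ := fun e => by
      rw [(eq_univ_iff_card x' u).1 e] at hu1; have := hm u; omega
    have hnf2 : x u ≠ univ := fun e => hnf ((hfull u).1 e)
    have := congrFun he u
    rw [ruleTheta_of_not_full hnf2, ruleTwo_of_not_full hnf] at this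
    have hc := congrArg Finset.card this
    rw [hu1] at hc
    have := card_le_card_cascade_add_one (x u)
    have := sbB_le x u
    omega
  · have hlt : 1 < (fullSet x').card := by
      have := Finset.card_pos.2 hne; omega
    obtain ⟨f₁, hf₁, hne₁⟩ := Finset.exists_mem_ne hlt ((fullSet x').min' hne)
    have h₀ : twoElt x' ((fullSet x').min' hne) = 0 := by
      unfold twoElt; rw [if_neg hc1, dif_pos hne, if_pos rfl]
    have h₁ : twoElt x' f₁ = 1 := by
      unfold twoElt; rw [if_neg hc1, dif_pos hne, if_neg hne₁]
    have e₀ := hmiss _ (mem_fullSet.1 (Finset.min'_mem _ hne))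
    have e₁ := hmiss f₁ (mem_fullSet.1 hf₁)
    omega

/-- rule (∅) never meets rule (2) -/
lemma ruleEmpty_ne_ruleTwo (hm : ∀ t, 3 ≤ m t) {x x' : SBConf m} (hf : ∃ t, x t = univ)
    (h1' : ∀ t, 1 ≤ (x' t).card) : ruleEmpty x ≠ ruleTwo x' := by
  intro he
  obtain ⟨f, hfu⟩ := hf
  have := congrFun he f
  rw [ruleEmpty_of_full hfu] at this
  have hc := congrArg Finset.card this
  rw [card_empty] at hc
  have := ruleTwo_card_pos hm h1' f
  omega

/-- rule (θ) is injective -/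
lemma ruleTheta_inj {x x' : SBConf m} {i i' : ℕ} (hi : ∀ t, i < m t) (hi' : ∀ t, i' < m t)
    (h2 : ∀ t, 2 ≤ (x t).card) (h2' : ∀ t, 2 ≤ (x' t).card) (hf : ∃ t, x t = univ)
    (he : ruleTheta i x = ruleTheta i' x') : x = x' ∧ i = i' := by
  have hfull : ∀ t, x t = univ ↔ x' t = univ := fun t => by
    rw [← ruleTheta_oneRed_iff hi h2 t, ← ruleTheta_oneRed_iff hi' h2' t, he]
  obtain ⟨f, hfu⟩ := hf
  have hii : i = i' := by
    have := congrFun he f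
    rw [ruleTheta_of_full hfu, ruleTheta_of_full ((hfull f).1 hfu)] at this
    exact uErase_inj (hi' f) this
  refine ⟨funext fun t => ?_, hii⟩
  by_cases h : x t = univ
  · rw [h, (hfull t).1 h]
  · have h' : x' t ≠ univ := fun e => h ((hfull t).2 e)
    have := congrFun he t
    rw [ruleTheta_of_not_full h, ruleTheta_of_not_full h'] at this
    have c1 := card_lt_of_not_full h
    have c2 := card_lt_of_not_full h'
    exact cascade_injOn (h2 t) (by omega) (h2' t) (by omega) this

/-- rule (∅) is injective -/
lemma ruleEmpty_inj {x x' : SBConf m} (h1 : ∀ t, 1 ≤ (x t).card) (h1' : ∀ t, 1 ≤ (x' t).card)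
    (he : ruleEmpty x = ruleEmpty x') : x = x' := by
  funext t
  have hfull : x t = univ ↔ x' t = univ := by
    rw [← ruleEmpty_eq_empty_iff h1 t, ← ruleEmpty_eq_empty_iff h1' t, he]
  by_cases h : x t = univ
  · rw [h, hfull.1 h]
  · have h' : x' t ≠ univ := fun e => h (hfull.2 e)
    have := congrFun he t
    rwa [ruleEmpty_of_not_full h, ruleEmpty_of_not_full h'] at this

/-- rule (2) is injective -/
lemma ruleTwo_inj (hm : ∀ t, 3 ≤ m t) {x x' : SBConf m} (hnor : ¬ HasOneRed x)
    (hnor' : ¬ HasOneRed x') (he : ruleTwo x = ruleTwo x') : x = x' := by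
  funext t
  have hfull : x t = univ ↔ x' t = univ := by
    rw [← ruleTwo_oneRed_iff hm hnor t, ← ruleTwo_oneRed_iff hm hnor' t, he]
  by_cases h : x t = univ
  · rw [h, hfull.1 h]
  · have h' : x' t ≠ univ := fun e => h (hfull.2 e)
    have := congrFun he t
    rwa [ruleTwo_of_not_full h, ruleTwo_of_not_full h'] at this

/-- **the assignment is injective** -/
theorem sbAssign_injective (hm : ∀ t, 3 ≤ m t) : Function.Injective (sbAssign (m := m)) := by
  intro q q' he
  obtain ⟨hf, h1⟩ := sb_src q.1.1.2.1
  obtain ⟨hf', h1'⟩ := sb_src q'.1.1.2.1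
  have hi : q.1.2.val < sbB m q.1.1.1 := q.2
  have hi' : q'.1.2.val < sbB m q'.1.1.1 := q'.2
  have him : ∀ t, q.1.2.val < m t :=
    fun t => lt_of_lt_of_le hi (le_trans (sbB_le _ t) (card_le_m _ t))
  have him' : ∀ t, q'.1.2.val < m t :=
    fun t => lt_of_lt_of_le hi' (le_trans (sbB_le _ t) (card_le_m _ t))
  unfold sbAssign at he
  by_cases h2 : 2 ≤ sbB m q.1.1.1 <;> by_cases h2' : 2 ≤ sbB m q'.1.1.1
  · rw [if_pos h2, if_pos h2'] at he
    have h2a : ∀ t, 2 ≤ (q.1.1.1 t).card := fun t => le_trans h2 (sbB_le _ t)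
    have h2a' : ∀ t, 2 ≤ (q'.1.1.1 t).card := fun t => le_trans h2' (sbB_le _ t)
    obtain ⟨hx, hii⟩ := ruleTheta_inj him him' h2a h2a' hf he
    exact slotL_ext q q' hx hii
  · rw [if_pos h2, if_neg h2'] at he
    have h2a : ∀ t, 2 ≤ (q.1.1.1 t).card := fun t => le_trans h2 (sbB_le _ t)
    by_cases hor' : HasOneRed q'.1.1.1
    · rw [if_pos hor'] at he
      exact absurd he (ruleTheta_ne_ruleEmpty hm him h2a hf')
    · rw [if_neg hor'] at he
      exact absurd he (ruleTheta_ne_ruleTwo hm him hi h2a hor' hf' h1' (by omega))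
  · rw [if_neg h2, if_pos h2'] at he
    have h2a' : ∀ t, 2 ≤ (q'.1.1.1 t).card := fun t => le_trans h2' (sbB_le _ t)
    by_cases hor : HasOneRed q.1.1.1
    · rw [if_pos hor] at he
      exact absurd he.symm (ruleTheta_ne_ruleEmpty hm him' h2a' hf)
    · rw [if_neg hor] at he
      exact absurd he.symm (ruleTheta_ne_ruleTwo hm him' hi' h2a' hor hf h1 (by omega))
  · rw [if_neg h2, if_neg h2'] at he
    have hi0 : q.1.2.val = q'.1.2.val := by omega
    by_cases hor : HasOneRed q.1.1.1 <;> by_cases hor' : HasOneRed q'.1.1.1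
    · rw [if_pos hor, if_pos hor'] at he
      exact slotL_ext q q' (ruleEmpty_inj h1 h1' he) hi0
    · rw [if_pos hor, if_neg hor'] at he
      exact absurd he (ruleEmpty_ne_ruleTwo hm hf h1')
    · rw [if_neg hor, if_pos hor'] at he
      exact absurd he.symm (ruleEmpty_ne_ruleTwo hm hf' h1)
    · rw [if_neg hor, if_neg hor'] at he
      exact slotL_ext q q' (ruleTwo_inj hm hor hor' he) hi0

/-- **THEOREM: (UH*) holds on every series of bundles `B_{m 0} ∧ … ∧ B_{m n}` with all `m t ≥ 3`.** -/
theorem universal_seriesBundles (hm : ∀ t, 3 ≤ m t) : Universal (sbR m) (sbB m) :=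
  ⟨sbAssign, sbAssign_injective hm, sbAssign_spec hm⟩

end seriesBundles

end Summit.Ventures.PercRepro2.UHClosure
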